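import Summits.RiemannHypothesis.RiemannHypothesis.Theorems.GroundBartaEvenWinsBeyondArchDeflationN83OLast
import Summits.RiemannHypothesis.RiemannHypothesis.Theorems.WeilFormatCDataO865OddRung
import Summits.RiemannHypothesis.RiemannHypothesis.Theorems.WeilParityEvenWinsBeyondArchFrontierCell8OfBlocks
import HarnessLib

/-!
# RiemannHypothesis / GroundBarta — the parity ladder: PARITY CELL 8 `(83/100, 173/200]` CLOSED

Helper file (`--supports stmt-RiemannHypothesis-18085`, `NoParityCrossing`), RH-free.  Prover A (g22 of unit `sr-gb-rung-a`).

The cell's two certified odd-sector lower bounds are in the tree: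
* cell 7: `n83O_oddLower_lit : 2/10¹⁷ ≤ ε_od(83/100)` (`…DeflationN83OLast`, format A′, prover A/B lanes), above `U((log 5)/2) = 10⁻¹⁷`;
* cell 8: `WeilFormatCData.O865.weilOddGroundEnergy_865_ge_inv_two_pow_60 : 2⁻⁶⁰ ≤ ε_od(173/200)` (`WeilFormatCDataO865OddRung`, the
  format-C ODD λ-run at `a = 173/200`, `μ = 2⁻⁶⁰`), above `U(83/100) = 483·10⁻²¹` (`trialUpper83sharp`).
Prover B g8's template `weilWindowSimpleEven_upTo_cell8_of_oddLowers` (`…FrontierCell8OfBlocks`: antitone bottoms on each cell) then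
gives the ladder up to `173/200`:

* `weilWindowSimpleEven_upTo_865` — for every `0 < a ≤ 173/200` the ground state of the windowed Weil form is simple and even;
* `weilEvenGroundEnergy_lt_weilOddGroundEnergy_upTo_865` — the strict parity order `ε_ev(a) < ε_od(a)` on `(0, 173/200]`;
* `tailSimpleEven_upTo_865` — the item-18085 tail shape (`log 2 < a ≤ 173/200`).

Standard axioms; nothing is defined; no RH claim (a finite-range parity certificate).
-/

set_option linter.dupNamespace false

noncomputable section

namespace Summit.RiemannHypothesis.RiemannHypothesis.Theorems.EvenWinsBeyondArch

open Literature.NumberTheory.LFunctions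

/-- **Parity cell 8 closed: the ladder reaches `173/200`.**  For every window `0 < a ≤ 173/200` the windowed Weil form has a simple,
even ground state. [folklore] -/
theorem weilWindowSimpleEven_upTo_865 : ∀ a : ℝ, 0 < a → a ≤ 173 / 200 → WeilWindowSimpleEven a :=
  weilWindowSimpleEven_upTo_cell8_of_oddLowers (L₇ := (2 : ℝ) / 10 ^ 17) (L₈ := (1 / 2 ^ 60 : ℝ)) (by norm_num)
    n83O_oddLower_lit (by norm_num) WeilFormatCData.O865.weilOddGroundEnergy_865_ge_inv_two_pow_60

/-- The strict parity order `ε_ev(a) < ε_od(a)` for every `0 < a ≤ 173/200`. [folklore] -/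
theorem weilEvenGroundEnergy_lt_weilOddGroundEnergy_upTo_865 {a : ℝ} (ha : 0 < a) (hle : a ≤ 173 / 200) :
    weilEvenGroundEnergy a < weilOddGroundEnergy a :=
  (weilWindowSimpleEven_iff_weilEvenGroundEnergy_lt ha).1 (weilWindowSimpleEven_upTo_865 a ha hle)

/-- Tail shape of item 18085 up to `173/200`: simple even ground states on every window `log 2 < a ≤ 173/200`. [folklore] -/
theorem tailSimpleEven_upTo_865 : ∀ a : ℝ, Real.log 2 < a → a ≤ 173 / 200 → WeilWindowSimpleEven a :=
  fun a ha hle ↦ weilWindowSimpleEven_upTo_865 a ((Real.log_pos (by norm_num)).trans ha) hle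

end Summit.RiemannHypothesis.RiemannHypothesis.Theorems.EvenWinsBeyondArch

end
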